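import Summits.QuantumFields.QCD.Theses.GapBuysCauchyRate

/-!
# Stub `stub_kappa3Transfer` (W3) of line `birth` for crux `GapBuysCauchyRate.LadderCauchyRate`
(item stmt-QuantumFields-17307, route route-QuantumFields-GapBuysCauchyRate, sub-problem QCD)

What is proved: the `κ₃` transfer law (W3) of reshape r6.  ASSUMING the general species
multilinearity of the lattice `n`-point functions (the statement of the neighbouring stub W1, taken
as a hypothesis: `S_n(reg.scheme m z shift) = (∏ᵢ z_{σᵢ}(k)) · S_n(reg.scheme m 1 shift)`), bare glue
skewness in scale-free form — real test functions `f, g, h` in the time slabs `x⁰ < 0`, `0 < x⁰ < 1`,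
`1 < x⁰` and `ε > 0` with `ε ≤ z_glue(m,k)³ · ‖S₃^{bare}(k; f, g, h)‖` eventually in `k`, `S₃^{bare}`
the three-point glue function of the `z ≡ 1` scheme with the family's shifts — gives the crux's
clause (iv) for the calibrated scheme `𝒞.scheme m`: the connected three-point combination
`S₃ − Σ S₁ S₂ + 2 S₁³` of `glue` stays `≥ ε` eventually, with the same `f, g, h, ε`.

How: for a calibrated family every renormalised one-point function vanishes
(`CalibratedSpeciesFamily.onePoint_eq_zero`; `![glue] = fun _ => glue` and `![f] = fun _ => f` on
`Fin 1`), so the combination collapses to `S₃(𝒞.scheme m)`; since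
`𝒞.scheme m = reg.scheme m (𝒞.z m) (𝒞.shift m)` definitionally, multilinearity at `n = 3` gives
`S₃(𝒞.scheme m) = z_glue(m,k)³ · S₃^{bare}`, whose norm is `z_glue(m,k)³ · ‖S₃^{bare}‖` because
`z > 0` (`CalibratedSpeciesFamily.z_pos`).  Sources: Montvay–Münster 1994 §5.1 (composite fields,
multiplicative renormalisation, vacuum subtraction); Glimm–Jaffe 1987 §6.1 (truncated functions).
Everything is proved.

Pure theorem file (no definitions): the registered stub signature, proved in tree vocabulary.
-/

noncomputable section

namespace Summit.QuantumFields.QCD.Cruxes.LadderCauchyRate.Birth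

open scoped BigOperators Topology
open MeasureTheory Filter
open Literature.MathematicalPhysics.AQFT Literature.Probability.LatticeModels
  Literature.MathematicalPhysics.QuantumLattice Literature.MathematicalPhysics.QuantumFieldTheory
open Summit.QuantumFields.QCD.Theses.GapBuysCauchyRate

/-- **One-point subtraction in `![·]` form.** For a calibrated family the renormalised lattice
one-point function of every species, written as `qcdLatticeSchwinger` at `n = 1` on the singleton
tuples `![s]`, `![f]`, vanishes (the one-point subtraction `CalibratedSpeciesFamily.onePoint_eq_zero`,
transported along `![a] = fun _ => a` on `Fin 1`). -/
theorem qcdLatticeSchwinger_one_vecCons_eq_zero {Nf : ℕ} {reg : QCDRegularisation Nf}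
    (𝒞 : CalibratedSpeciesFamily reg) (m : Fin Nf → ℝ) (k : ℕ) (s : QCDField Nf)
    (f : SchwartzMap (EuclideanSpace ℝ (Fin 4)) ℝ) :
    qcdLatticeSchwinger (𝒞.scheme m) k 1 ![s] ![f] = 0 := by
  have hs : (![s] : Fin 1 → QCDField Nf) = fun _ => s := by
    funext i
    fin_cases i
    rfl
  have hf : (![f] : Fin 1 → SchwartzMap (EuclideanSpace ℝ (Fin 4)) ℝ) = fun _ => f := by
    funext i
    fin_cases i
    rfl
  rw [hs, hf, ← QCDScheme.onePoint_eq]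
  exact 𝒞.onePoint_eq_zero m s k f

/-- **(W3) `κ₃` transfer** (reshape r6 of line `birth`): general species multilinearity of the lattice
`n`-point functions ⇒ (bare glue skewness in scale-free form at the mass tuple `m` ⇒ the `κ₃` clause
(iv) of the crux `LadderCauchyRate` for the calibrated scheme `𝒞.scheme m`).  The subtracted one-point
functions vanish, so the connected three-point combination is the calibrated three-point function,
which is `z_glue(m,k)³` times the bare one. -/
theorem stub_kappa3Transfer :
    (∀ (Nf : ℕ) (reg : QCDRegularisation Nf) (m : Fin Nf → ℝ) (z shift : QCDField Nf → ℕ → ℝ) (k n : ℕ)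
      (σ : Fin n → QCDField Nf) (f : Fin n → SchwartzMap (EuclideanSpace ℝ (Fin 4)) ℝ),
      qcdLatticeSchwinger (reg.scheme m z shift) k n σ f =
        (∏ i, ((z (σ i) k : ℝ) : ℂ)) *
          qcdLatticeSchwinger (reg.scheme m (fun _ _ => (1 : ℝ)) shift) k n σ f) →
    ∀ (Nf : ℕ) (reg : QCDRegularisation Nf) (𝒞 : CalibratedSpeciesFamily reg) (m : Fin Nf → ℝ),
      (∃ f g h : SchwartzMap (EuclideanSpace ℝ (Fin 4)) ℝ,
        tsupport (f : EuclideanSpace ℝ (Fin 4) → ℝ) ⊆ {x | x 0 < 0} ∧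
        tsupport (g : EuclideanSpace ℝ (Fin 4) → ℝ) ⊆ {x | 0 < x 0 ∧ x 0 < 1} ∧
        tsupport (h : EuclideanSpace ℝ (Fin 4) → ℝ) ⊆ {x | 1 < x 0} ∧
        ∃ ε > (0 : ℝ), ∀ᶠ k in Filter.atTop,
          ε ≤ (𝒞.z m QCDField.glue k) ^ 3 *
            ‖qcdLatticeSchwinger (reg.scheme m (fun _ _ => (1 : ℝ)) (𝒞.shift m)) k 3
              ![QCDField.glue, QCDField.glue, QCDField.glue] ![f, g, h]‖) →
      ∃ f g h : SchwartzMap (EuclideanSpace ℝ (Fin 4)) ℝ, tsupport (f : EuclideanSpace ℝ (Fin 4) → ℝ) ⊆ {x | x 0 < 0} ∧ tsupport (g : EuclideanSpace ℝ (Fin 4) → ℝ) ⊆ {x | 0 < x 0 ∧ x 0 < 1} ∧ tsupport (h : EuclideanSpace ℝ (Fin 4) → ℝ) ⊆ {x | 1 < x 0} ∧ ∃ ε > (0 : ℝ), ∀ᶠ k in Filter.atTop, ε ≤ ‖qcdLatticeSchwinger (𝒞.scheme m) k 3 ![QCDField.glue, QCDField.glue, QCDField.glue] ![f, g, h] - qcdLatticeSchwinger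 (𝒞.scheme m) k 1 ![QCDField.glue] ![f] * qcdLatticeSchwinger (𝒞.scheme m) k 2 ![QCDField.glue, QCDField.glue] ![g, h] - qcdLatticeSchwinger (𝒞.scheme m) k 1 ![QCDField.glue] ![g] * qcdLatticeSchwinger (𝒞.scheme m) k 2 ![QCDField.glue, QCDField.glue] ![f, h] - qcdLatticeSchwinger (𝒞.scheme m) k 1 ![QCDField.glue] ![h] * qcdLatticeSchwinger (𝒞.scheme m) k 2 ![QCDField.glue, QCDField.glue] ![f, g] + 2 * (qcdLatticeSchwinger (𝒞.scheme m) k 1 ![QCDField.glue] ![f] * qcdLatticeSchwinger (𝒞.scheme m) k 1 ![QCDField.glue] ![g] * qcdLatticeSchwinger (𝒞.scheme m) k 1 ![QCDField.glue] ![h])‖ := by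
  intro hW1 Nf reg 𝒞 m hbare
  obtain ⟨f, g, h, hf, hg, hh, ε, hε, hev⟩ := hbare
  refine ⟨f, g, h, hf, hg, hh, ε, hε, hev.mono fun k hk => ?_⟩
  rw [qcdLatticeSchwinger_one_vecCons_eq_zero 𝒞 m k QCDField.glue f,
    qcdLatticeSchwinger_one_vecCons_eq_zero 𝒞 m k QCDField.glue g,
    qcdLatticeSchwinger_one_vecCons_eq_zero 𝒞 m k QCDField.glue h]
  simp only [zero_mul, mul_zero, sub_zero, add_zero]
  have h3 : qcdLatticeSchwinger (𝒞.scheme m) k 3 ![QCDField.glue, QCDField.glue, QCDField.glue]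
      ![f, g, h] =
      (∏ i, ((𝒞.z m ((![QCDField.glue, QCDField.glue, QCDField.glue] : Fin 3 → QCDField Nf) i) k :
        ℝ) : ℂ)) *
        qcdLatticeSchwinger (reg.scheme m (fun _ _ => (1 : ℝ)) (𝒞.shift m)) k 3
          ![QCDField.glue, QCDField.glue, QCDField.glue] ![f, g, h] :=
    hW1 Nf reg m (𝒞.z m) (𝒞.shift m) k 3 _ _
  have hσ : ∀ i : Fin 3,
      (![QCDField.glue, QCDField.glue, QCDField.glue] : Fin 3 → QCDField Nf) i = QCDField.glue := by
    intro i
    fin_cases i <;> rfl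
  have hprod : (∏ i, ((𝒞.z m ((![QCDField.glue, QCDField.glue, QCDField.glue] : Fin 3 → QCDField Nf) i)
      k : ℝ) : ℂ)) = ((𝒞.z m QCDField.glue k : ℝ) : ℂ) ^ 3 := by
    simp_rw [hσ]
    rw [Finset.prod_const, Finset.card_univ, Fintype.card_fin]
  rw [h3, hprod, norm_mul, norm_pow, Complex.norm_of_nonneg (𝒞.z_pos m QCDField.glue k).le]
  exact hk

end Summit.QuantumFields.QCD.Cruxes.LadderCauchyRate.Birth

end
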